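/-
Copyright (c) 2026 the pub-hodgecm-mathlib formalisation cell (harness21).  Prover seat hodgecm-mathlib-K2Liu-p03 (g9), Track B «K2-LIT» ∕ hLiu418 #184♮ =
`stmt-HodgeConjecture-24832`, socket #41 KIND 1, block K1-b♮ (dec-2-pay) F3-loc (LEAD F0P6-plan (g16) BATCH #278 (2); K1b desk K2Liu-p14 (g5) WORD #15 (2)):
«THE RANK-ONE LOCAL WHITTAKER-TYPE INTEGRAL OF A SIEGEL SECTION CONVERGES ABSOLUTELY AT EVERY FINITE PLACE, WITH AN EXPLICIT MAJORANT».
THEOREMS ONLY (no `def`, no `instance`, no notation, no named-fact hypothesis, no `sorry`); lane `--supports stmt-HodgeConjecture-24832 --as helper`.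
-/
import Summits.HodgeConjecture.HodgeConjecture.Theorems.K2LiuUnipDeltaRankOneHaar           -- ★ rank-one coordinate `b ↦ n(ι_v b δ)` at EVERY place, Haar transport, ★ GK engine, ★ `w_Δ n(X) = p(X) k(X)`
import Summits.HodgeConjecture.HodgeConjecture.Theorems.K2LiuSiegelCharacterUnramifiedShift -- ★ `norm_localSiegelCharacter` (`|χ_v(det_Δ p)| = 1` for unitary `χ_v`)
import Summits.HodgeConjecture.HodgeConjecture.Theorems.K2LiuLocalIntertwiningProperty      -- ★ `absDetDelta_pos`
import Summits.HodgeConjecture.HodgeConjecture.Theorems.K2LiuGKRankOneIdentityLFactor       -- ★ `prod_norm_toPlace_eq_sq` (`∏_{w∣v} ‖ι_w y‖_w = ‖y‖_v²`)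
import Summits.HodgeConjecture.HodgeConjecture.Theorems.K2LiuSiegelCocycleLetters             -- ★ `norm_eq_coe_normAbs` (Mathlib's norm on `F_v` = `normAbs`)
import Mathlib.MeasureTheory.Integral.Bochner.ContinuousLinearMap                         -- `integral_complex_ofReal`
import HarnessLib

/-!
# Crux `HLiu418`, socket #41, KIND 1 b♮ (dec-2-pay) F3-loc — `K2LiuKindOneLineLocalAbsoluteMajorant`: THE RANK-ONE LOCAL WHITTAKER-TYPE INTEGRAL
# `∫_{N_Δ(F_v)} ψ(u) · f(w_Δ · u · x) dν_N(u)` CONVERGES ABSOLUTELY AT EVERY FINITE PLACE `v`, WITH THE MAJORANT `B · max(1, c_δ^{re s+½}) · μ(𝒪_v) · (1 − q_v^{−2 re s})⁻¹`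

Cell `hodgecm-mathlib`, crux item hLiu418 = `stmt-HodgeConjecture-24832` (helper lane, count-neutral).  Namespace `…Cruxes.HLiu418.K2LiuKindOneLineLocalAbsoluteMajorant`.
WHY.  The K1-b♮ block letter's finite half `Ffin = A·∏_{v∈T} W_{i,v}` (K2Liu-p11 (g6) F1 ★-bound `hFfin`; F2 LH4-p14 (g9)) is a product of RANK-ONE local integrals
`W = ∫_{N_Δ(L⁺_v)} conj ψ(u)·φ((w_Δ)_v·u·x_v) dν_v` of Siegel sections `φ ∈ I_v(s′, χ_v)` of the doubled LINE `H₁(F_v) ≅ U(1,1)(F_v)` at `s′ = s + ½`; ★ F3-asm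
`K2LiuKindOneLineFiniteHalfBound.hFfin_of_placeBounds` multiplies per-place bounds up.  THIS FILE is the per-place ANALYSIS, generic (any quadratic `E∕F`, `c`, `δ`, any
non-degenerate `1 × 1` Gram datum `T₀`, ANY finite place `v` — no `|2|_w = |δ|_w = 1`, no unramifiedness): in the coordinate `b ↦ n(ι_v b·δ)` (`F_v ≅ N_Δ(F_v)`, ★
`K2LiuUnipDeltaRankOneHaar` at every place) the Bruhat factorisation ★ `weylDelta_mul_nElem_eq` `w_Δ n(X_b) = p(X_b)·k(X_b)` (`X_b = ι_v b·δ` invertible for `b ≠ 0`,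
`k(X_b) = w_Δ n(X_b⁻¹) w_Δ = w_Δ n(X_{b⁻¹ d⁻¹}) w_Δ`, `δ² = d`) and the section law give, for `‖b‖ > 1`,
`f(w_Δ n(X_b) x) = χ_v(det_Δ p)|det_Δ p|_v^{s+½} · f(k(X_b)·x)` with `|det_Δ p(X_b)|_v = ∏_{w∣v}‖ι_w(b)⁻¹ δ_w⁻¹‖_w = ‖b‖_v^{−2}·c_δ` (★ `prod_norm_toPlace_eq_sq`), so the
integrand is dominated by `B·max(1, c_δ^{re s+½})·(max 1 ‖b‖)^{−(2 re s+1)}`, and ★ `K2LiuGKRankOneIntegral.integrable_and_integral_max_one_normAbs_cpow` integrates the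
majorant: `μ(𝒪_v)·(1 − q_v^{−(2re s+1)})∕(1 − q_v^{−2 re s}) ≤ μ(𝒪_v)·(1 − q_v^{−2re s})⁻¹` — ABSOLUTE CONVERGENCE FOR `0 < re s` (the line's `s′ = s + ½` has `re s′ > ½`).
The two VALUE letters stay hypothesis-first (F2 names the factor class; their payer is the translate-size file): `hnear` (`‖f(w_Δ n(X_b) x)‖ ≤ B` on `‖b‖ ≤ 1`) and
`hfar` (`‖f(w_Δ n(X_{b′}) w_Δ x)‖ ≤ B` on `‖b′‖ ≤ ‖d⁻¹‖` — the compact far cell).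
* §0 tools (★ `K2LiuSiegelCocycleLetters.norm_eq_coe_normAbs` by import) — `continuous_of_isSmooth'` (smooth ⇒ locally constant ⇒ continuous; ★ A7's lemma re-proved to keep the import closure small), `inv_delta_eq`, `coord_inv_eq_coord`
  (`X_b⁻¹ = X_{b⁻¹ d⁻¹}`), `absDetDelta_pElem_coord` (`|det_Δ p(X_b)|_v = ‖b⁻¹‖²·c_δ`), `integral_max_one_norm_rpow_neg_le` (the real form of ★ GK's majorant integral:
  `∫ (max 1 ‖b‖)^{−z} dμ ≤ μ(𝒪)·(1 − q^{1−z})⁻¹`, `z > 1`);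
* §1 **`integrable_and_norm_integral_coord_le`** — on `F_v` (any additive Haar `μ`): integrability of `b ↦ ψ(n_b)·f(w_Δ n_b x)` and the displayed bound;
* §2 **`integrable_and_norm_integral_le`** — on `N_Δ(F_v)` (any Haar `ν_N`; `μ := ν_N ∘ ψ⁻¹` the transported measure of ★ `integral_comp_coord`).
References: [Casselman1980, §3 Thm. 3.1]; [KudlaRallis1994, §2]; [HarrisKudlaSweet1996, §1 (1.11)–(1.15), §6 (6.14)–(6.16)]; [Kudla1994, §3]; [Shimura1997, §18.4];
[Weil1965, §37]; [Tate1950, §2.4].  HONEST LABEL: HC_CM is proved only modulo the 7 printed citations (2 remaining named inputs: hLiu418 = stmt-HodgeConjecture-24832,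
h413 = stmt-HodgeConjecture-24833) until rung 0 closes; count-neutral helper (`--supports stmt-HodgeConjecture-24832 --as helper`), hypothesis-first in `hnear hfar`.
-/

set_option autoImplicit false
set_option linter.dupNamespace false -- the mandated namespace repeats `HodgeConjecture.HodgeConjecture`

noncomputable section

open NumberField IsDedekindDomain Matrix MeasureTheory Topology
open scoped ValuativeRel NNReal
open Literature.NumberTheory.GaloisRepresentations.IsNonarchimedeanLocalField
open Literature.NumberTheory.Automorphic Literature.NumberTheory.Automorphic.UnitaryGroup
open Literature.NumberTheory.GelbartRogawski1991.AdaptedBlocks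
open Literature.NumberTheory.GelbartRogawski1991.UnitaryDualPair.LocalSplitting
open Literature.NumberTheory.K2Lit.LocalSiegelDoubled
open Summit.HodgeConjecture.HodgeConjecture.Cruxes.HLiu418.K2LiuUnipDeltaLocalCoordinates
open Summit.HodgeConjecture.HodgeConjecture.Cruxes.HLiu418.K2LiuUnipDeltaRankOneCoordinates
open Summit.HodgeConjecture.HodgeConjecture.Cruxes.HLiu418.K2LiuUnipDeltaRankOneHaar
open Summit.HodgeConjecture.HodgeConjecture.Cruxes.HLiu418.K2LiuSiegelWeylUnipotentIwasawa
open Summit.HodgeConjecture.HodgeConjecture.Cruxes.HLiu418.K2LiuGKRankOneIntegral (integrable_and_integral_max_one_normAbs_cpow)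
open Summit.HodgeConjecture.HodgeConjecture.Cruxes.HLiu418.K2LiuSiegelCharacterUnramifiedShift (norm_localSiegelCharacter)
open Summit.HodgeConjecture.HodgeConjecture.Cruxes.HLiu418.K2LiuLocalIntertwiningProperty (absDetDelta_pos)
open Summit.HodgeConjecture.HodgeConjecture.Cruxes.HLiu418.K2LiuGKRankOneIdentityLFactor (prod_norm_toPlace_eq_sq)

namespace Summit.HodgeConjecture.HodgeConjecture.Cruxes.HLiu418.K2LiuKindOneLineLocalAbsoluteMajorant

variable (F : Type) [Field F] [NumberField F] (E : Type) [Field E] [NumberField E] [Algebra F E]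
  [Algebra.IsQuadraticExtension F E] (c : E ≃ₐ[F] E) {δ : E} (hcδ : c δ = -δ) (hδ : δ ≠ 0) {d : F} (hd : δ * δ = algebraMap F E d)
  (v : HeightOneSpectrum (𝓞 F))

/-! ## §0 Tools -/

section Tools

variable (n : ℕ) {JDn : Matrix (Fin (n + n)) (Fin (n + n)) E}

omit [Algebra.IsQuadraticExtension F E] in
/-- **smooth ⇒ continuous**: a function on `H(F_v)` right-invariant under an open subgroup is locally constant (★ A7 `continuous_of_isSmooth`, re-proved here to keep
the import closure small). [cite: Casselman1980, §3] -/
theorem continuous_of_isSmooth' {f : UnitaryGroup.localPi E c (n + n) JDn v → ℂ} (hf : IsSmooth F E c v n f) : Continuous f := by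
  obtain ⟨U, hU⟩ := hf
  refine ((IsLocallyConstant.iff_eventually_eq f).2 fun h => ?_).continuous
  refine Filter.mem_of_superset ((U.isOpen.preimage (show Continuous (fun y : UnitaryGroup.localPi E c (n + n) JDn v => h⁻¹ * y) from
    continuous_const.mul continuous_id)).mem_nhds ?_) fun y hy => ?_
  · simp only [Set.mem_preimage, inv_mul_cancel]; exact U.one_mem
  · have hy' := hU h (h⁻¹ * y) hy
    rw [mul_inv_cancel_left] at hy'
    exact hy'

end Tools

section RankOne

variable {T₀ : Matrix (Fin 1) (Fin 1) F} (hT₀d : IsUnit T₀.det)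
  {JD : Matrix (Fin (1 + 1)) (Fin (1 + 1)) E} (hJD : JD = (gramD F 1 T₀).map (algebraMap F E))

omit [NumberField F] [NumberField E] [Algebra.IsQuadraticExtension F E] in
include hd hδ in
/-- `δ⁻¹ = d⁻¹·δ` (`δ² = d`). [folklore] -/
theorem inv_delta_eq : δ⁻¹ = algebraMap F E d⁻¹ * δ := by
  have hd0 : algebraMap F E d ≠ 0 := by rw [← hd]; exact mul_ne_zero hδ hδ
  rw [map_inv₀, ← hd, _root_.mul_inv_rev, mul_assoc, inv_mul_cancel₀ hδ, mul_one]

omit [Algebra.IsQuadraticExtension F E] in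
include hd hδ in
/-- **`X_b⁻¹ = X_{b⁻¹ d⁻¹}`**: the inverse of the coordinate matrix `X_b = (ι_v b·δ)` is the coordinate matrix of `b⁻¹·d⁻¹` (`δ⁻¹ = d⁻¹ δ`). [folklore] -/
theorem coord_inv_eq_coord {b : v.adicCompletion F} (hb : b ≠ 0) :
    (Matrix.of fun _ _ : Fin 1 => toLocalRing E v b * algebraMap E (LocalRing E v) δ)⁻¹ =
      Matrix.of fun _ _ : Fin 1 => toLocalRing E v (b⁻¹ * ((d⁻¹ : F) : v.adicCompletion F)) * algebraMap E (LocalRing E v) δ := by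
  rw [coord_inv F E v hδ hb]
  ext i j
  rw [Matrix.of_apply, Matrix.of_apply, inv_delta_eq F E hδ hd, map_mul, map_mul, toLocalRing_coe, mul_assoc]

include hcδ hδ hT₀d hJD in
/-- **`|det_Δ p(X_b)|_v = ‖b⁻¹‖² · c_δ`** with `c_δ = ∏_{w∣v} ‖δ_w⁻¹‖_w`, for the `P_Δ`-factor `p(X_b) = w_Δ n(X_b) w_Δ n(−X_b⁻¹) w_Δ` of ★ `weylDelta_mul_nElem_eq`
(`det_Δ p(X)_w = det(−X⁻¹)_w` ★ `detDelta_pElem`, ★ `prod_norm_toPlace_eq_sq`). [cite: HarrisKudlaSweet1996, §6 (6.14)–(6.16)] [cite: Kudla1994, §3] -/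
theorem absDetDelta_pElem_coord {b : v.adicCompletion F} (hb : b ≠ 0)
    (hXn : ((-(Matrix.of fun _ _ : Fin 1 => toLocalRing E v b * algebraMap E (LocalRing E v) δ)⁻¹).map (conjLocal E c v))ᵀ * gramS F E v 1 T₀ +
      gramS F E v 1 T₀ * (-(Matrix.of fun _ _ : Fin 1 => toLocalRing E v b * algebraMap E (LocalRing E v) δ)⁻¹) = 0) :
    absDetDelta F E c v 1 (weylDelta F E c v 1 hJD *
        nElem F E c v 1 hJD (Matrix.of fun _ _ : Fin 1 => toLocalRing E v b * algebraMap E (LocalRing E v) δ) (skew_coord F E c hcδ v hT₀d b) *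
        weylDelta F E c v 1 hJD * nElem F E c v 1 hJD (-(Matrix.of fun _ _ : Fin 1 => toLocalRing E v b * algebraMap E (LocalRing E v) δ)⁻¹) hXn *
        weylDelta F E c v 1 hJD) =
      ‖b⁻¹‖ ^ 2 * ∏ w : PlacesOver E v, ‖((δ⁻¹ : E) : w.1.adicCompletion E)‖ := by
  unfold absDetDelta
  rw [← prod_norm_toPlace_eq_sq F E v b⁻¹, ← Finset.prod_mul_distrib]
  refine Finset.prod_congr rfl fun w _ => ?_
  rw [detDelta_pElem F E c v 1 hJD _ (skew_coord F E c hcδ v hT₀d b) (isUnit_det_coord F E v hδ hb) hXn w, coord_inv F E v hδ hb, Matrix.det_neg,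
    Matrix.det_fin_one, Matrix.of_apply, Fintype.card_fin, pow_one, neg_one_mul, Pi.neg_apply, coord_apply F E v b⁻¹ w, norm_neg, norm_mul]

omit [Algebra.IsQuadraticExtension F E] in
/-- `(s + 1∕2).re = re s + 1∕2` (the exponent of ★ `norm_localSiegelCharacter` at `n = 1`). [folklore] -/
theorem localSiegelExponent_re_rankOne (s : ℂ) : (s + ((1 : ℕ) : ℂ) / 2).re = s.re + 1 / 2 := by
  simp [Complex.add_re]

variable [MeasurableSpace (v.adicCompletion F)] [BorelSpace (v.adicCompletion F)]

omit [Algebra.IsQuadraticExtension F E] in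
/-- **THE REAL FORM OF ★ GK's MAJORANT INTEGRAL**: for `z > 1` and any additive Haar `μ` on `F_v`, `b ↦ (max 1 ‖b‖)^{−z}` is `μ`-integrable and
`∫ (max 1 ‖b‖)^{−z} dμ ≤ μ(𝒪_v) · (1 − q_v^{1−z})⁻¹` (★ `integrable_and_integral_max_one_normAbs_cpow`: the value is `μ(𝒪_v)·(1 − q^{−z})∕(1 − q^{1−z})`).
[cite: Casselman1980, §3 Thm. 3.1] [cite: Tate1950, §2.4] -/
theorem integral_max_one_norm_rpow_neg_le (μ : Measure (v.adicCompletion F)) [μ.IsAddHaarMeasure] {z : ℝ} (hz : 1 < z) :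
    Integrable (fun b : v.adicCompletion F => (max 1 ‖b‖) ^ (-z)) μ ∧
      ∫ b, (max 1 ‖b‖) ^ (-z) ∂μ ≤ μ.real (primePowBall (v.adicCompletion F) 0) * (1 - (v.residueCard : ℝ) ^ (1 - z))⁻¹ := by
  have hq1 : (1 : ℝ) < (v.residueCard : ℝ) := by exact_mod_cast v.one_lt_residueCard
  have hq0 : (0 : ℝ) < (v.residueCard : ℝ) := one_pos.trans hq1
  obtain ⟨hI, hV⟩ := integrable_and_integral_max_one_normAbs_cpow (F := v.adicCompletion F) μ (z := (z : ℂ)) (by rwa [Complex.ofReal_re])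
  have hpt : ∀ b : v.adicCompletion F, ((max 1 ((normAbs (v.adicCompletion F) b : ℝ≥0) : ℝ) : ℝ) : ℂ) ^ (-(z : ℂ)) = (((max 1 ‖b‖) ^ (-z) : ℝ) : ℂ) := by
    intro b
    rw [← K2LiuSiegelCocycleLetters.norm_eq_coe_normAbs F v b, ← Complex.ofReal_neg, ← Complex.ofReal_cpow (zero_le_one.trans (le_max_left 1 ‖b‖))]
  simp_rw [hpt] at hI hV
  have hm0 : ∀ b : v.adicCompletion F, 0 ≤ (max 1 ‖b‖) ^ (-z) := fun b => Real.rpow_nonneg (zero_le_one.trans (le_max_left 1 ‖b‖)) _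
  have hIr : Integrable (fun b : v.adicCompletion F => (max 1 ‖b‖) ^ (-z)) μ :=
    hI.norm.congr (Filter.Eventually.of_forall fun b => by simp only [Complex.norm_real, Real.norm_of_nonneg (hm0 b)])
  refine ⟨hIr, ?_⟩
  -- the value, as a real number
  have hq : (residueFieldCard (v.adicCompletion F) : ℂ) = (((v.residueCard : ℕ) : ℝ) : ℂ) := by
    rw [residueFieldCard_adicCompletion_eq]; push_cast; rfl
  have hval : ∫ b, (max 1 ‖b‖) ^ (-z) ∂μ = μ.real (primePowBall (v.adicCompletion F) 0) *
      ((1 - (v.residueCard : ℝ) ^ (-z)) / (1 - (v.residueCard : ℝ) ^ (1 - z))) := by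
    apply Complex.ofReal_injective
    rw [← integral_complex_ofReal, hV, hq]
    push_cast [Complex.ofReal_cpow hq0.le]
    ring
  rw [hval]
  have hlt : (v.residueCard : ℝ) ^ (1 - z) < 1 := Real.rpow_lt_one_of_one_lt_of_neg hq1 (by linarith)
  have hpos : 0 < 1 - (v.residueCard : ℝ) ^ (1 - z) := by linarith
  have hnum : 1 - (v.residueCard : ℝ) ^ (-z) ≤ 1 := by linarith [Real.rpow_nonneg hq0.le (-z)]
  rw [div_eq_mul_inv]
  exact mul_le_mul_of_nonneg_left (mul_le_of_le_one_left (inv_nonneg.2 hpos.le) hnum) measureReal_nonneg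

/-! ## §1 The majorant on `F_v` -/

include hδ hd in
/-- **THE RANK-ONE ABSOLUTE MAJORANT ON `F_v`.**  Data: a quadratic `E∕F` with `c, δ` (`δ² = d`), a `1×1` Gram datum `T₀` (`det T₀` a unit), ANY finite place `v`, an additive Haar `μ`
on `F_v`; a unitary `χ_v`; `0 < re s`; a SMOOTH Siegel section `f ∈ I_v(s, χ_v)` of `H(F_v) = U(T₀ ⊕ −T₀)(F_v)`; a continuous weight `ψ` with `‖ψ‖ ≤ 1`; a translate `x`; and the
two VALUE letters `hnear` (`‖f(w_Δ n(X_b) x)‖ ≤ B` for `‖b‖ ≤ 1`) and `hfar` (`‖f(w_Δ n(X_{b′}) w_Δ x)‖ ≤ B` for `‖b′‖ ≤ ‖d⁻¹‖`).  THEN `b ↦ ψ(n(X_b))·f(w_Δ n(X_b) x)` is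
`μ`-integrable and `‖∫ ψ(n(X_b)) f(w_Δ n(X_b) x) dμ(b)‖ ≤ B · max(1, c_δ^{re s+½}) · μ(𝒪_v) · (1 − q_v^{−2 re s})⁻¹`, `c_δ = ∏_{w∣v}‖δ_w⁻¹‖_w`.
[cite: Casselman1980, §3 Thm. 3.1] [cite: KudlaRallis1994, §2] [cite: HarrisKudlaSweet1996, §1 (1.15), §6 (6.14)–(6.16)] [cite: Kudla1994, §3] -/
theorem integrable_and_norm_integral_coord_le (hT₀ : T₀.IsSymm) (μ : Measure (v.adicCompletion F)) [μ.IsAddHaarMeasure]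
    {χv : ∀ w : PlacesOver E v, (w.1.adicCompletion E)ˣ →* ℂˣ} (hχu : ∀ (w : PlacesOver E v) (u : (w.1.adicCompletion E)ˣ), ‖((χv w u : ℂˣ) : ℂ)‖ = 1)
    {s : ℂ} (hs : 0 < s.re) {f : UnitaryGroup.localPi E c (1 + 1) JD v → ℂ}
    (hf : IsLocalSiegelSection F E c hcδ hδ hd v 1 hT₀ hJD χv s f) (hsm : IsSmooth F E c v 1 f)
    (ψ : UnitaryGroup.localPi E c (1 + 1) JD v → ℂ) (hψc : Continuous ψ) (hψ1 : ∀ u, ‖ψ u‖ ≤ 1)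
    (x : UnitaryGroup.localPi E c (1 + 1) JD v) {B : ℝ} (hB : 0 ≤ B)
    (hnear : ∀ b : v.adicCompletion F, ‖b‖ ≤ 1 →
      ‖f (weylDelta F E c v 1 hJD * nElem F E c v 1 hJD (Matrix.of fun _ _ : Fin 1 => toLocalRing E v b * algebraMap E (LocalRing E v) δ) (skew_coord F E c hcδ v hT₀d b) * x)‖ ≤ B)
    (hfar : ∀ b' : v.adicCompletion F, ‖b'‖ ≤ ‖((d⁻¹ : F) : v.adicCompletion F)‖ →
      ‖f (weylDelta F E c v 1 hJD * nElem F E c v 1 hJD (Matrix.of fun _ _ : Fin 1 => toLocalRing E v b' * algebraMap E (LocalRing E v) δ) (skew_coord F E c hcδ v hT₀d b') *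
        weylDelta F E c v 1 hJD * x)‖ ≤ B) :
    Integrable (fun b : v.adicCompletion F =>
        ψ (nElem F E c v 1 hJD (Matrix.of fun _ _ : Fin 1 => toLocalRing E v b * algebraMap E (LocalRing E v) δ) (skew_coord F E c hcδ v hT₀d b)) *
          f (weylDelta F E c v 1 hJD * nElem F E c v 1 hJD (Matrix.of fun _ _ : Fin 1 => toLocalRing E v b * algebraMap E (LocalRing E v) δ) (skew_coord F E c hcδ v hT₀d b) * x)) μ ∧
      ‖∫ b : v.adicCompletion F,
          ψ (nElem F E c v 1 hJD (Matrix.of fun _ _ : Fin 1 => toLocalRing E v b * algebraMap E (LocalRing E v) δ) (skew_coord F E c hcδ v hT₀d b)) *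
            f (weylDelta F E c v 1 hJD * nElem F E c v 1 hJD (Matrix.of fun _ _ : Fin 1 => toLocalRing E v b * algebraMap E (LocalRing E v) δ) (skew_coord F E c hcδ v hT₀d b) * x) ∂μ‖ ≤
        B * max 1 ((∏ w : PlacesOver E v, ‖((δ⁻¹ : E) : w.1.adicCompletion E)‖) ^ (s.re + 1 / 2)) *
          μ.real (primePowBall (v.adicCompletion F) 0) * (1 - (v.residueCard : ℝ) ^ (-(2 * s.re)))⁻¹ := by
  -- abbreviations (opaque, with defining equations: no `let`-bodies for the normalisers to unfold)
  obtain ⟨nb, hnb⟩ : ∃ nb : v.adicCompletion F → UnitaryGroup.localPi E c (1 + 1) JD v, ∀ b,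
      nElem F E c v 1 hJD (Matrix.of fun _ _ : Fin 1 => toLocalRing E v b * algebraMap E (LocalRing E v) δ) (skew_coord F E c hcδ v hT₀d b) = nb b :=
    ⟨_, fun _ => rfl⟩
  have hnbc : Continuous nb := by
    have h := continuous_subtype_val.comp (continuous_nElem_coord F E c hcδ v hT₀d hJD)
    refine h.congr fun b => ?_
    simp only [Function.comp_apply, hnb]
  simp only [hnb] at hnear hfar ⊢
  obtain ⟨z, hz⟩ : ∃ z : ℝ, z = 2 * s.re + 1 := ⟨_, rfl⟩
  have hz1 : 1 < z := by rw [hz]; linarith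
  obtain ⟨cδ, hcδdef⟩ : ∃ cδ : ℝ, cδ = ∏ w : PlacesOver E v, ‖((δ⁻¹ : E) : w.1.adicCompletion E)‖ := ⟨_, rfl⟩
  have hcδ0 : 0 ≤ cδ := by rw [hcδdef]; exact Finset.prod_nonneg fun _ _ => norm_nonneg _
  rw [← hcδdef]
  obtain ⟨M, hM⟩ : ∃ M : ℝ, M = max 1 (cδ ^ (s.re + 1 / 2)) := ⟨_, rfl⟩
  have hM1 : 1 ≤ M := by rw [hM]; exact le_max_left _ _
  have hM0 : 0 ≤ M := zero_le_one.trans hM1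
  have hMc : cδ ^ (s.re + 1 / 2) ≤ M := by rw [hM]; exact le_max_right _ _
  rw [← hM]
  obtain ⟨m, hm⟩ : ∃ m : v.adicCompletion F → ℝ, ∀ b, m b = (max 1 ‖b‖) ^ (-z) := ⟨_, fun _ => rfl⟩
  have hfc : Continuous f := continuous_of_isSmooth' F E c v 1 hsm
  have hGc : Continuous fun b : v.adicCompletion F => ψ (nb b) * f (weylDelta F E c v 1 hJD * nb b * x) :=
    (hψc.comp hnbc).mul (hfc.comp ((continuous_const.mul hnbc).mul continuous_const))
  -- (1) the pointwise majorant
  have hpt : ∀ b : v.adicCompletion F, ‖ψ (nb b) * f (weylDelta F E c v 1 hJD * nb b * x)‖ ≤ B * M * m b := by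
    intro b
    rw [norm_mul]
    by_cases hb : ‖b‖ ≤ 1
    · have hmb : m b = 1 := by rw [hm, max_eq_left hb, Real.one_rpow]
      rw [hmb, mul_one]
      calc ‖ψ (nb b)‖ * ‖f (weylDelta F E c v 1 hJD * nb b * x)‖ ≤ 1 * B := mul_le_mul (hψ1 _) (hnear b hb) (norm_nonneg _) zero_le_one
        _ = B * 1 := by rw [one_mul, mul_one]
        _ ≤ B * M := mul_le_mul_of_nonneg_left hM1 hB
    · rw [not_le] at hb
      have hb0 : b ≠ 0 := fun h => by rw [h, norm_zero] at hb; exact not_lt.2 zero_le_one hb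
      have hmb : m b = ‖b‖ ^ (-z) := by rw [hm, max_eq_right hb.le]
      -- the Bruhat factorisation `w_Δ n(X_b) = p · k`
      have hX := skew_coord F E c hcδ v hT₀d b
      have hXu : IsUnit (Matrix.of fun _ _ : Fin 1 => toLocalRing E v b * algebraMap E (LocalRing E v) δ).det := isUnit_det_coord F E v hδ hb0
      have hXi := skew_inv (conjLocal E c v) hXu hX
      have hXn := skew_neg F E c v 1 hXi
      have hfac := weylDelta_mul_nElem_eq F E c v 1 hJD _ hX hXu hXi hXn
      have hp := isSiegelDelta_pElem F E c hcδ hδ hd v 1 hT₀ hJD _ hX hXu hXn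
      have habs := absDetDelta_pElem_coord F E c hcδ hδ v hT₀d hJD hb0 hXn
      rw [hnb] at hfac hp habs
      rw [← hcδdef] at habs
      -- `k(X_b) = w_Δ n(X_{b'}) w_Δ`, `b' = b⁻¹ d⁻¹`
      have hXinv := coord_inv_eq_coord F E hδ hd v hb0
      have hk : weylDelta F E c v 1 hJD * nElem F E c v 1 hJD _ hXi * weylDelta F E c v 1 hJD =
          weylDelta F E c v 1 hJD * nb (b⁻¹ * ((d⁻¹ : F) : v.adicCompletion F)) * weylDelta F E c v 1 hJD := by
        rw [nElem_congr F E c v hJD hXinv hXi (skew_coord F E c hcδ v hT₀d _), hnb]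
      have hb'le : ‖b⁻¹ * ((d⁻¹ : F) : v.adicCompletion F)‖ ≤ ‖((d⁻¹ : F) : v.adicCompletion F)‖ := by
        rw [norm_mul, norm_inv]
        exact mul_le_of_le_one_left (norm_nonneg _) (inv_le_one_of_one_le₀ hb.le)
      -- the section law
      have hval : f (weylDelta F E c v 1 hJD * nb b * x) =
          localSiegelCharacter F E c v 1 χv s
              (weylDelta F E c v 1 hJD * nb b * weylDelta F E c v 1 hJD * nElem F E c v 1 hJD _ hXn * weylDelta F E c v 1 hJD) *
            f (weylDelta F E c v 1 hJD * nb (b⁻¹ * ((d⁻¹ : F) : v.adicCompletion F)) * weylDelta F E c v 1 hJD * x) := by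
        rw [← hk, ← hf _ hp, ← mul_assoc _ (weylDelta F E c v 1 hJD * nElem F E c v 1 hJD _ hXi * weylDelta F E c v 1 hJD) x, ← hfac]
      -- the modulus of the character
      have hσ1 : ‖localSiegelCharacter F E c v 1 χv s
            (weylDelta F E c v 1 hJD * nb b * weylDelta F E c v 1 hJD * nElem F E c v 1 hJD _ hXn * weylDelta F E c v 1 hJD)‖ =
          (‖b⁻¹‖ ^ 2 * cδ) ^ (s.re + 1 / 2) := by
        rw [norm_localSiegelCharacter F E c v 1 χv hχu s _ (absDetDelta_pos F E c hcδ hδ hd v 1 hT₀ hJD hp), habs, localSiegelExponent_re_rankOne]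
      have hσ2 : (‖b⁻¹‖ ^ 2 * cδ) ^ (s.re + 1 / 2) = ‖b‖ ^ (-z) * cδ ^ (s.re + 1 / 2) := by
        rw [Real.mul_rpow (pow_nonneg (norm_nonneg _) 2) hcδ0, norm_inv, ← Real.rpow_natCast, ← Real.rpow_mul (inv_nonneg.2 (norm_nonneg b)),
          Real.inv_rpow (norm_nonneg b), ← Real.rpow_neg (norm_nonneg b)]
        congr 2
        rw [hz]; push_cast; ring
      rw [hval, norm_mul, hσ1, hσ2, hmb]
      have h1 := hfar _ hb'le
      have h3 : 0 ≤ ‖b‖ ^ (-z) := Real.rpow_nonneg (norm_nonneg b) _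
      have h5 : ‖b‖ ^ (-z) * cδ ^ (s.re + 1 / 2) * ‖f (weylDelta F E c v 1 hJD * nb (b⁻¹ * ((d⁻¹ : F) : v.adicCompletion F)) * weylDelta F E c v 1 hJD * x)‖ ≤
          ‖b‖ ^ (-z) * M * B :=
        mul_le_mul (mul_le_mul_of_nonneg_left hMc h3) h1 (norm_nonneg _) (mul_nonneg h3 hM0)
      have h6 : 0 ≤ ‖b‖ ^ (-z) * M * B := mul_nonneg (mul_nonneg h3 hM0) hB
      calc ‖ψ (nb b)‖ * (‖b‖ ^ (-z) * cδ ^ (s.re + 1 / 2) * ‖f (weylDelta F E c v 1 hJD * nb (b⁻¹ * ((d⁻¹ : F) : v.adicCompletion F)) * weylDelta F E c v 1 hJD * x)‖)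
          ≤ ‖ψ (nb b)‖ * (‖b‖ ^ (-z) * M * B) := mul_le_mul_of_nonneg_left h5 (norm_nonneg _)
        _ ≤ 1 * (‖b‖ ^ (-z) * M * B) := mul_le_mul_of_nonneg_right (hψ1 _) h6
        _ = B * M * ‖b‖ ^ (-z) := by rw [one_mul, mul_comm (‖b‖ ^ (-z)) M, mul_comm (M * ‖b‖ ^ (-z)) B, mul_assoc]
  -- (2) the majorant is integrable with the GK value
  obtain ⟨hmI, hmV⟩ := integral_max_one_norm_rpow_neg_le F v μ hz1
  simp only [← hm] at hmI hmV
  have hmI' : Integrable (fun b => B * M * m b) μ := hmI.const_mul (B * M)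
  -- (3) assembly
  refine ⟨Integrable.mono' hmI' hGc.aestronglyMeasurable (Filter.Eventually.of_forall hpt), ?_⟩
  have hz' : 1 - z = -(2 * s.re) := by rw [hz]; ring
  rw [← hz']
  calc ‖∫ b, ψ (nb b) * f (weylDelta F E c v 1 hJD * nb b * x) ∂μ‖ ≤ ∫ b, B * M * m b ∂μ :=
        norm_integral_le_of_norm_le hmI' (Filter.Eventually.of_forall hpt)
    _ = B * M * ∫ b, m b ∂μ := integral_const_mul _ _
    _ ≤ B * M * (μ.real (primePowBall (v.adicCompletion F) 0) * (1 - (v.residueCard : ℝ) ^ (1 - z))⁻¹) :=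
        mul_le_mul_of_nonneg_left hmV (mul_nonneg hB hM0)
    _ = B * M * μ.real (primePowBall (v.adicCompletion F) 0) * (1 - (v.residueCard : ℝ) ^ (1 - z))⁻¹ := by ring

/-! ## §2 The majorant on `N_Δ(F_v)` -/

include hδ hd in
/-- **THE RANK-ONE ABSOLUTE MAJORANT ON `N_Δ(F_v)`** (any Haar `ν_N` on `N_Δ(F_v)`, ANY finite place `v`; stated for ANY subgroup `N′ = N_Δ(F_v)` — the `subst`
pattern of ★ (KW1-b2) §2, so that the K2Lit global-comap carrier `unipDeltaLoc v` is served by ★ B1 `unipDeltaLoc_eq_unipDeltaLocal`): with the letters of §1, `u ↦ ψ(u)·f(w_Δ u x)` is `ν_N`-integrable and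
`‖∫_{N_Δ(F_v)} ψ(u) f(w_Δ u x) dν_N(u)‖ ≤ B · max(1, c_δ^{re s+½}) · μ(𝒪_v) · (1 − q_v^{−2 re s})⁻¹`, where `μ := ν_N ∘ ψ⁻¹` is the transported (additive Haar, ★
`isAddHaarMeasure_map_coordInv`) measure on `F_v` of ★ `integral_comp_coord` (at a place with `|2|_w = |δ|_w = 1`, `μ(𝒪_v) = ν_N(N_Δ(F_v) ∩ K_v)` ★ `map_coordInv_primePowBall_zero`).
[cite: Casselman1980, §3 Thm. 3.1] [cite: KudlaRallis1994, §2] [cite: HarrisKudlaSweet1996, §1 (1.15), §6 (6.14)–(6.16)] [cite: Weil1965, §37] -/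
theorem integrable_and_norm_integral_le (hT₀ : T₀.IsSymm) {N' : Subgroup (UnitaryGroup.localPi E c (1 + 1) JD v)} (hN' : N' = unipDeltaLocal F E c v 1 (JD := JD))
    [MeasurableSpace ↥N'] [BorelSpace ↥N'] (νN : Measure ↥N') [νN.IsHaarMeasure]
    {χv : ∀ w : PlacesOver E v, (w.1.adicCompletion E)ˣ →* ℂˣ} (hχu : ∀ (w : PlacesOver E v) (u : (w.1.adicCompletion E)ˣ), ‖((χv w u : ℂˣ) : ℂ)‖ = 1)
    {s : ℂ} (hs : 0 < s.re) {f : UnitaryGroup.localPi E c (1 + 1) JD v → ℂ}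
    (hf : IsLocalSiegelSection F E c hcδ hδ hd v 1 hT₀ hJD χv s f) (hsm : IsSmooth F E c v 1 f)
    (ψ : UnitaryGroup.localPi E c (1 + 1) JD v → ℂ) (hψc : Continuous ψ) (hψ1 : ∀ u, ‖ψ u‖ ≤ 1)
    (x : UnitaryGroup.localPi E c (1 + 1) JD v) {B : ℝ} (hB : 0 ≤ B)
    (hnear : ∀ b : v.adicCompletion F, ‖b‖ ≤ 1 →
      ‖f (weylDelta F E c v 1 hJD * nElem F E c v 1 hJD (Matrix.of fun _ _ : Fin 1 => toLocalRing E v b * algebraMap E (LocalRing E v) δ) (skew_coord F E c hcδ v hT₀d b) * x)‖ ≤ B)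
    (hfar : ∀ b' : v.adicCompletion F, ‖b'‖ ≤ ‖((d⁻¹ : F) : v.adicCompletion F)‖ →
      ‖f (weylDelta F E c v 1 hJD * nElem F E c v 1 hJD (Matrix.of fun _ _ : Fin 1 => toLocalRing E v b' * algebraMap E (LocalRing E v) δ) (skew_coord F E c hcδ v hT₀d b') *
        weylDelta F E c v 1 hJD * x)‖ ≤ B) :
    Integrable (fun u : ↥N' =>
        ψ (u : UnitaryGroup.localPi E c (1 + 1) JD v) * f (weylDelta F E c v 1 hJD * (u : UnitaryGroup.localPi E c (1 + 1) JD v) * x)) νN ∧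
      ‖∫ u : ↥N',
          ψ (u : UnitaryGroup.localPi E c (1 + 1) JD v) * f (weylDelta F E c v 1 hJD * (u : UnitaryGroup.localPi E c (1 + 1) JD v) * x) ∂νN‖ ≤
        B * max 1 ((∏ w : PlacesOver E v, ‖((δ⁻¹ : E) : w.1.adicCompletion E)‖) ^ (s.re + 1 / 2)) *
          (Measure.map (fun u : ↥N' =>
              ((quadraticLocalEquiv E v c hcδ hδ).symm (blkB (matA F E c v 1 (u : UnitaryGroup.localPi E c (1 + 1) JD v)) 0 0)).2) νN).real
            (primePowBall (v.adicCompletion F) 0) * (1 - (v.residueCard : ℝ) ^ (-(2 * s.re)))⁻¹ := by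
  subst hN'
  haveI := isAddHaarMeasure_map_coordInv F E c hcδ hδ v hT₀d hJD νN
  obtain ⟨hI, hle⟩ := integrable_and_norm_integral_coord_le F E c hcδ hδ hd v hT₀d hJD hT₀
    (Measure.map (fun u : unipDeltaLocal F E c v 1 (JD := JD) =>
      ((quadraticLocalEquiv E v c hcδ hδ).symm (blkB (matA F E c v 1 (u : UnitaryGroup.localPi E c (1 + 1) JD v)) 0 0)).2) νN)
    hχu hs hf hsm ψ hψc hψ1 x hB hnear hfar
  refine ⟨?_, ?_⟩
  · obtain ⟨e, he, hes⟩ := exists_homeomorph_coord F E c hcδ hδ v hT₀d hJD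
    rw [show (fun u : unipDeltaLocal F E c v 1 (JD := JD) =>
        ((quadraticLocalEquiv E v c hcδ hδ).symm (blkB (matA F E c v 1 (u : UnitaryGroup.localPi E c (1 + 1) JD v)) 0 0)).2) = ⇑e.symm
      from funext fun u => (hes u).symm, ← Homeomorph.toMeasurableEquiv_coe, integrable_map_equiv] at hI
    refine hI.congr (Filter.Eventually.of_forall fun u => ?_)
    have h1 : nElem F E c v 1 hJD (Matrix.of fun _ _ : Fin 1 => toLocalRing E v (e.symm u) * algebraMap E (LocalRing E v) δ)
        (skew_coord F E c hcδ v hT₀d (e.symm u)) = (u : UnitaryGroup.localPi E c (1 + 1) JD v) := by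
      have h := congrArg Subtype.val (he (e.symm u))
      rw [e.apply_symm_apply] at h
      exact h.symm
    simp only [Function.comp_apply, Homeomorph.toMeasurableEquiv_coe, h1]
  · rw [show (∫ u : unipDeltaLocal F E c v 1 (JD := JD),
          ψ (u : UnitaryGroup.localPi E c (1 + 1) JD v) * f (weylDelta F E c v 1 hJD * (u : UnitaryGroup.localPi E c (1 + 1) JD v) * x) ∂νN) = _
      from integral_comp_coord F E c hcδ hδ v hT₀d hJD νN (fun g => ψ g * f (weylDelta F E c v 1 hJD * g * x))]
    exact hle

end RankOne

end Summit.HodgeConjecture.HodgeConjecture.Cruxes.HLiu418.K2LiuKindOneLineLocalAbsoluteMajorant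

end
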